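import Summits.Parity.GeneralizedHardyLittlewood.Theorems.LeeYangFibresRelativeDimOneTypeClassMomentsCells
import Summits.Parity.GeneralizedHardyLittlewood.Theorems.LeeYangFibresRelativeDimOneTypeClassMomentsExpansion
import Summits.Parity.GeneralizedHardyLittlewood.Theorems.LeeYangFibresRelativeDimOneTypeClassMomentsWindows
import Summits.Parity.GeneralizedHardyLittlewood.Theorems.LeeYangFibresRelativeDimOneTypeClassMomentsTools
import HarnessLib

/-!
# Type-class moving moments from the class second moment: the registered stub `stub_typeClassMoments`
(crux stmt-Parity-14113 `LeeYangFibres.RelativeDimOne`, line gallagher-backwards-split, RESHAPED type-conditioned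
split; part 5/5 of the series `…TypeClassMoments{Cells,Expansion,Windows,Tools}`)

`stub_typeClassMoments : ∀ θ₁ θ₁', θ₁' < θ₁ → θ₁ < 1 → LowClassSecondMoment θ₁ → TypeClassMoments θ₁'`.

Proof. For one position `n < W` of the windows the cell sum
`Σ_{c ∈ typeCell} ∏_i (ψ(a_i n+u_i+X_i; q, a_i n+c_i) − ψ(a_i n+u_i−1; q, a_i n+c_i))` is re-indexed by the
translation `c ↦ (a_i n + c_i mod q)_i` of the cell (part A) and evaluated by `cell_moment_bound` below: the
multilinear expansion over the cell (part B; its one-deviation terms collapse to the GLOBAL prime number theorem by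
the unit-scaling symmetry of the cell, part A) fed with Brun–Titchmarsh `ψ(x;q,r) ≤ C x/φ(q)`
(`classPsi_le_of_level θ₁`), the class variance `Σ_r (ψ(x;q,r) − [r unit] x/φ)² ≤ ε₁ x²/φ(q)`
(`classVariance_of_lowClassSecondMoment θ₁` — where the HYPOTHESIS `LowClassSecondMoment θ₁` enters; the level
condition `q ≤ x^{θ₁}` at the heights `x ≥ δN` holds eventually because `q ≤ N^{θ₁'}` and `θ₁' < θ₁`), the PNT
`|ψ(x) − x| ≤ ε₂ x` (part C1), and the thresholds `4 log³(LN) N^{θ₁} (log₂ N + 1)^t 2^t C_b^t ≤ (ε/2)δN` etc.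
(part C1, with `q/φ(q) ≤ log₂ q + 1`). Summing over `n < W` with `coprimePairs = W · #cellU` (part A) gives the
claim; for `θ₁ ≤ 0` the statement is vacuous (part D).
-/

noncomputable section

open scoped BigOperators Classical Topology ArithmeticFunction.vonMangoldt
open Finset Filter
open Summit.Parity.GeneralizedHardyLittlewood.Cruxes.RelativeDimOne.GallagherBackwards (classPsi classPsi_nonneg)
open Summit.Parity.GeneralizedHardyLittlewood.Cruxes.RelativeDimOne.GallagherBackwardsSplit

namespace Summit.Parity.GeneralizedHardyLittlewood.Cruxes.RelativeDimOne.TypeSplit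

namespace TCM

/-- **The cell moment bound at ONE position of the windows** (`lo_i < hi_i`, `hi_i − lo_i = Y_i ≥ δN`,
`q ≤ lo_i ≤ hi_i ≤ LN`): given Brun–Titchmarsh at `hi_i`, the class variances and the PNT at both heights, and the
threshold inequalities, the cell sum of `∏_i (ψ(hi_i;q,c_i) − ψ(lo_i;q,c_i))` is `∏ Y_i/φ^t · #cellU` up to
`ε ∏ Y_i (#cellU/φ^t + #cell/q^t)` — the expansion bound (part B) fed with the window inputs (part C1) and the
collapse identity (part A). -/
theorem cell_moment_bound {t : ℕ} (q : ℕ) (hq : 0 < q) (a b₀ : Fin t → ℤ) (lo hi : Fin t → ℕ)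
    (Y : Fin t → ℝ) (N L δ ε C ε₁ ε₂ J₀ : ℝ)
    (hN : 0 < N) (hL : 1 ≤ L) (hδ : 0 < δ) (hε : 0 < ε) (hC : 0 < C) (hε₁ : 0 < ε₁) (hε₂ : 0 < ε₂)
    (hJ0 : 0 ≤ J₀)
    (hY : ∀ i, ((hi i : ℕ) : ℝ) - lo i = Y i) (hYδ : ∀ i, δ * N ≤ Y i)
    (hlohi : ∀ i, lo i ≤ hi i) (hqlo : ∀ i, q ≤ lo i) (hhi : ∀ i, ((hi i : ℕ) : ℝ) ≤ L * N)
    (hBT : ∀ i r, classPsi (hi i) q r ≤ C * hi i / Nat.totient q)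
    (hVhi : ∀ i, ∑ r ∈ range q,
      (classPsi (hi i) q r - if r.Coprime q then ((hi i : ℕ) : ℝ) / Nat.totient q else 0) ^ 2 ≤
        ε₁ * ((hi i : ℕ) : ℝ) ^ 2 / Nat.totient q)
    (hVlo : ∀ i, ∑ r ∈ range q,
      (classPsi (lo i) q r - if r.Coprime q then ((lo i : ℕ) : ℝ) / Nat.totient q else 0) ^ 2 ≤
        ε₁ * ((lo i : ℕ) : ℝ) ^ 2 / Nat.totient q)
    (hPhi : ∀ i, |∑ m ∈ Icc 1 (hi i), Λ m - hi i| ≤ ε₂ * hi i)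
    (hPlo : ∀ i, |∑ m ∈ Icc 1 (lo i), Λ m - lo i| ≤ ε₂ * lo i)
    (hJhi : ∀ i, 4 * Real.log (hi i) ^ 3 ≤ J₀)
    (hJ1 : J₀ * q ≤ δ * N) (hJ2 : J₀ ≤ ε₂ * L * N)
    (hJ3 : 2 ^ t * (C * L / δ + 1) ^ t * ((q : ℝ) / Nat.totient q) ^ t * q * J₀ ≤ ε / 2 * δ * N)
    (hE1 : 2 ^ t * (C * L / δ + 1) ^ t * (4 * ε₁ * L ^ 2 / δ ^ 2) ≤ ε / 4)
    (hE2 : 2 ^ t * (C * L / δ + 1) ^ t * (3 * ε₂ * L / δ) ≤ ε / 4) :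
    |∑ c ∈ typeCell q q a b₀, ∏ i, (classPsi (hi i) q (c i) - classPsi (lo i) q (c i)) -
        (∏ i, Y i) / (Nat.totient q : ℝ) ^ t *
          ((typeCell q q a b₀).filter (fun c => ∀ j, Nat.Coprime (c j) q)).card| ≤
      ε * (∏ i, Y i) *
        ((((typeCell q q a b₀).filter (fun c => ∀ j, Nat.Coprime (c j) q)).card : ℝ) /
            (Nat.totient q : ℝ) ^ t +
          ((typeCell q q a b₀).card : ℝ) / (q : ℝ) ^ t) := by
  -- opaque abbreviations
  obtain ⟨φ, hφ⟩ : ∃ φ : ℝ, φ = Nat.totient q := ⟨_, rfl⟩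
  obtain ⟨Cb, hCb⟩ : ∃ Cb : ℝ, Cb = C * L / δ + 1 := ⟨_, rfl⟩
  simp only [← hφ] at hBT hVhi hVlo hJ3 ⊢
  simp only [← hCb] at hJ3 hE1 hE2
  obtain ⟨cell, hcell_def⟩ : ∃ cell : Finset (Fin t → ℕ), cell = typeCell q q a b₀ := ⟨_, rfl⟩
  simp only [← hcell_def]
  -- basic positivity
  have hq0 : (0 : ℝ) < q := by exact_mod_cast hq
  have hφ0 : 0 < φ := by rw [hφ]; exact_mod_cast Nat.totient_pos.2 hq
  have hφq : φ ≤ q := by rw [hφ]; exact_mod_cast Nat.totient_le q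
  have hCb1 : 1 ≤ Cb := by
    rw [hCb]
    have : 0 ≤ C * L / δ := by positivity
    linarith
  have hCb0 : 0 < Cb := by linarith
  have hY0 : ∀ i, 0 < Y i := fun i => lt_of_lt_of_le (by positivity) (hYδ i)
  have hNY : ∀ i, N ≤ Y i / δ := fun i => by rw [le_div_iff₀ hδ, mul_comm]; exact hYδ i
  have hL0 : 0 < L := by linarith
  have hhi1 : ∀ i, 1 ≤ hi i := fun i => lt_of_lt_of_le hq ((hqlo i).trans (hlohi i))
  have hqhi : ∀ i, q ≤ hi i := fun i => (hqlo i).trans (hlohi i)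
  have hloL : ∀ i, ((lo i : ℕ) : ℝ) ≤ L * N := fun i => le_trans (by exact_mod_cast hlohi i) (hhi i)
  -- the data of the expansion bound
  obtain ⟨D, hD⟩ : ∃ D : Fin t → ℕ → ℝ, D = fun i r => classPsi (hi i) q r - classPsi (lo i) q r :=
    ⟨_, rfl⟩
  obtain ⟨M, hM⟩ : ∃ M : Fin t → ℝ, M = fun i => Y i / φ := ⟨_, rfl⟩
  obtain ⟨B, hB⟩ : ∃ B : Fin t → ℝ, B = fun i => Cb * Y i / φ := ⟨_, rfl⟩
  obtain ⟨ρP, hρP⟩ : ∃ ρP : ℝ, ρP = 3 * ε₂ * L / (δ * Cb) := ⟨_, rfl⟩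
  obtain ⟨ρV, hρV⟩ : ∃ ρV : ℝ, ρV = 4 * ε₁ * L ^ 2 / (δ ^ 2 * Cb ^ 2) := ⟨_, rfl⟩
  obtain ⟨ρJ, hρJ⟩ : ∃ ρJ : ℝ, ρJ = J₀ * φ / (Cb * δ * N) := ⟨_, rfl⟩
  have hρP0 : 0 ≤ ρP := by rw [hρP]; positivity
  have hρV0 : 0 ≤ ρV := by rw [hρV]; positivity
  have hρJ0 : 0 ≤ ρJ := by rw [hρJ]; positivity
  -- the hypotheses of the expansion bound
  have h_cell : ∀ c ∈ cell, ∀ i, c i < q := fun c hc i => by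
    rw [hcell_def] at hc
    exact (mem_typeCell.1 hc).1 i
  have h_D0 : ∀ i r, 0 ≤ D i r := fun i r => by
    rw [hD]; exact sub_nonneg.2 (classPsi_mono (hlohi i) q r)
  have h_Dle : ∀ i r, D i r ≤ classPsi (hi i) q r := fun i r => by
    rw [hD]; dsimp only; linarith [classPsi_nonneg (lo i) q r]
  have hCL : C * L / δ ≤ Cb := by rw [hCb]; linarith
  have h_B0 : ∀ i, 0 < B i := fun i => by
    have hYi := hY0 i
    rw [hB]; dsimp only; positivity
  have h_MB : ∀ i, 0 ≤ M i ∧ M i ≤ B i := fun i => by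
    have hYi := hY0 i
    rw [hM, hB]; dsimp only
    refine ⟨by positivity, ?_⟩
    rw [mul_div_assoc]
    exact le_mul_of_one_le_left (by positivity) hCb1
  have h_BD : ∀ i r, r < q → r.Coprime q → D i r ≤ B i := fun i r _ _ => by
    have hYi := (hY0 i).le
    rw [hB]; dsimp only
    calc D i r ≤ classPsi (hi i) q r := h_Dle i r
      _ ≤ C * hi i / φ := hBT i r
      _ ≤ C * (L * N) / φ := by gcongr; exact hhi i
      _ ≤ C * (L * (Y i / δ)) / φ := by gcongr; exact hNY i
      _ = (C * L / δ) * Y i / φ := by ring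
      _ ≤ Cb * Y i / φ := by gcongr
  have h_JD : ∀ i r, r < q → ¬ r.Coprime q → D i r ≤ J₀ := fun i r _ hr => by
    calc D i r ≤ classPsi (hi i) q r := h_Dle i r
      _ ≤ 4 * Real.log (hi i) ^ 3 := BrunTitchmarshAP.classPsi_le_of_not_coprime hq (hqhi i) hr
      _ ≤ J₀ := hJhi i
  have h_JB : ∀ i, J₀ ≤ B i := fun i => by
    rw [hB]; dsimp only
    rw [le_div_iff₀ hφ0]
    calc J₀ * φ ≤ J₀ * q := mul_le_mul_of_nonneg_left hφq hJ0
      _ ≤ δ * N := hJ1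
      _ ≤ Y i := hYδ i
      _ ≤ Cb * Y i := le_mul_of_one_le_left (hY0 i).le hCb1
  have h_Jρ : ∀ i, J₀ ≤ ρJ * B i := fun i => by
    rw [hB, hρJ]; dsimp only
    have e : J₀ * φ / (Cb * δ * N) * (Cb * Y i / φ) = J₀ * (Y i / (δ * N)) := by
      field_simp
    rw [e]
    have h1 : 1 ≤ Y i / (δ * N) := by rw [le_div_iff₀ (by positivity)]; linarith [hYδ i]
    exact le_mul_of_one_le_right hJ0 h1
  have h_units : (((range q).filter (fun r => r.Coprime q)).card : ℝ) = φ := by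
    rw [card_units_eq_totient, hφ]
  have h_P : ∀ i, |∑ r ∈ (range q).filter (fun r => r.Coprime q), (D i r - M i)| ≤ ρP * φ * B i := by
    intro i
    have e1 : ∑ r ∈ (range q).filter (fun r => r.Coprime q), (D i r - M i) =
        ∑ r ∈ (range q).filter (fun r => r.Coprime q), (classPsi (hi i) q r - classPsi (lo i) q r) -
          (((hi i : ℕ) : ℝ) - lo i) := by
      rw [Finset.sum_sub_distrib, Finset.sum_const, nsmul_eq_mul, h_units, hM, hD, hY i]
      dsimp only
      field_simp
    have e2 : ρP * φ * B i = 3 * ε₂ * L * (Y i / δ) := by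
      rw [hρP, hB]; dsimp only; field_simp
    rw [e1, e2]
    calc _ ≤ |∑ m ∈ Icc 1 (hi i), Λ m - hi i| + |∑ m ∈ Icc 1 (lo i), Λ m - lo i| +
          4 * Real.log (hi i) ^ 3 := window_pnt q (lo i) (hi i) hq (hqhi i) (hlohi i)
      _ ≤ ε₂ * hi i + ε₂ * lo i + J₀ := add_le_add (add_le_add (hPhi i) (hPlo i)) (hJhi i)
      _ ≤ ε₂ * (L * N) + ε₂ * (L * N) + ε₂ * L * N := by
          gcongr
          · exact hhi i
          · exact hloL i
      _ = 3 * ε₂ * L * N := by ring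
      _ ≤ 3 * ε₂ * L * (Y i / δ) := by gcongr; exact hNY i
  have h_V : ∀ i, ∑ r ∈ (range q).filter (fun r => r.Coprime q), (D i r - M i) ^ 2 ≤
      ρV * φ * B i ^ 2 := by
    intro i
    have e1 : ∀ r, D i r - M i =
        classPsi (hi i) q r - classPsi (lo i) q r - (((hi i : ℕ) : ℝ) - lo i) / φ := by
      intro r; rw [hD, hM]; dsimp only; rw [← hY i]
    simp only [e1]
    have e2 : ρV * φ * B i ^ 2 = 4 * ε₁ * L ^ 2 * (Y i / δ) ^ 2 / φ := by
      rw [hρV, hB]; dsimp only; field_simp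
    rw [e2]
    have hw := window_variance q (lo i) (hi i) φ _ _ (hVhi i) (hVlo i)
    calc _ ≤ 2 * (ε₁ * ((hi i : ℕ) : ℝ) ^ 2 / φ) + 2 * (ε₁ * ((lo i : ℕ) : ℝ) ^ 2 / φ) := hw
      _ = 2 * ε₁ * (((hi i : ℕ) : ℝ) ^ 2 + ((lo i : ℕ) : ℝ) ^ 2) / φ := by ring
      _ ≤ 2 * ε₁ * ((L * N) ^ 2 + (L * N) ^ 2) / φ := by
          gcongr
          · exact hhi i
          · exact hloL i
      _ = 4 * ε₁ * L ^ 2 * N ^ 2 / φ := by ring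
      _ ≤ 4 * ε₁ * L ^ 2 * (Y i / δ) ^ 2 / φ := by gcongr; exact hNY i
  have h_fib : ∀ i (F : ℕ → ℝ), ∑ c ∈ cell.filter (fun c => ∀ j, (c j).Coprime q), F (c i) =
      ((cell.filter (fun c => ∀ j, (c j).Coprime q)).card : ℝ) / φ *
        ∑ r ∈ (range q).filter (fun r => r.Coprime q), F r := by
    intro i F
    rw [hcell_def, hφ]
    exact sum_cellU_apply hq a b₀ i F
  -- the expansion bound
  have key := expansion_bound q cell D M B φ ρP ρV ρJ J₀ hφ0 hρP0 hρV0 hρJ0 hJ0 h_cell h_D0 h_B0 h_MB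
    h_BD h_JD h_JB h_Jρ h_P h_V h_fib
  have hPM : ∏ i, M i = (∏ i, Y i) / φ ^ t := by rw [hM]; exact prod_div_const φ Y
  have hPB : ∏ i, B i = Cb ^ t * (∏ i, Y i) / φ ^ t := by rw [hB]; exact prod_mul_div_const Cb φ Y
  have hSD : ∑ c ∈ cell, ∏ i, D i (c i) =
      ∑ c ∈ cell, ∏ i, (classPsi (hi i) q (c i) - classPsi (lo i) q (c i)) := by rw [hD]
  rw [hSD, hPM, hPB] at key
  refine key.trans ?_
  -- the final inequality between the two error shapes (`error_shape_le`, part D)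
  have hPY0 : 0 ≤ ∏ i, Y i := Finset.prod_nonneg fun i _ => (hY0 i).le
  have hK0 : (0 : ℝ) ≤ ((cell.filter (fun c => ∀ j, (c j).Coprime q)).card : ℝ) := Nat.cast_nonneg _
  have hcc0 : (0 : ℝ) ≤ (cell.card : ℝ) := Nat.cast_nonneg _
  generalize (∏ i, Y i) = PY at hPY0 ⊢
  generalize ((cell.filter (fun c => ∀ j, (c j).Coprime q)).card : ℝ) = K at hK0 ⊢
  generalize (cell.card : ℝ) = cc at hcc0 ⊢
  subst hρP hρV hρJ
  exact error_shape_le t hq0 hφ0 hφq hCb1 hε hε₁.le hε₂.le hL0.le hδ hN hJ0 hPY0 hK0 hcc0 hJ3 hE1 hE2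

/-- The main case `0 < θ₁`. -/
theorem typeClassMoments_of_pos {θ₁ θ₁' : ℝ} (hθ' : θ₁' < θ₁) (hθ₁ : θ₁ < 1) (hθ0 : 0 < θ₁)
    (hL2M : LowClassSecondMoment θ₁) : TypeClassMoments θ₁' := by
  intro t L ht δ ε hδ hε
  -- constants
  obtain ⟨C, hC, x₀B, hBT⟩ := classPsi_le_of_level θ₁ hθ₁
  obtain ⟨Lr, hLr⟩ : ∃ Lr : ℝ, Lr = max (L : ℝ) 1 := ⟨_, rfl⟩
  have hLr1 : 1 ≤ Lr := by rw [hLr]; exact le_max_right _ _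
  have hLLr : (L : ℝ) ≤ Lr := by rw [hLr]; exact le_max_left _ _
  have hLr0 : 0 < Lr := by linarith
  obtain ⟨Cb, hCb⟩ : ∃ Cb : ℝ, Cb = C * Lr / δ + 1 := ⟨_, rfl⟩
  have hCb0 : 0 < Cb := by rw [hCb]; positivity
  obtain ⟨ε₁, hε₁⟩ : ∃ ε₁ : ℝ, ε₁ = ε * δ ^ 2 / (16 * 2 ^ t * Cb ^ t * Lr ^ 2) := ⟨_, rfl⟩
  obtain ⟨ε₂, hε₂⟩ : ∃ ε₂ : ℝ, ε₂ = ε * δ / (12 * 2 ^ t * Cb ^ t * Lr) := ⟨_, rfl⟩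
  have hε₁0 : 0 < ε₁ := by rw [hε₁]; positivity
  have hε₂0 : 0 < ε₂ := by rw [hε₂]; positivity
  have hE1 : 2 ^ t * (C * Lr / δ + 1) ^ t * (4 * ε₁ * Lr ^ 2 / δ ^ 2) ≤ ε / 4 := by
    rw [← hCb, hε₁]; apply le_of_eq; field_simp; ring
  have hE2 : 2 ^ t * (C * Lr / δ + 1) ^ t * (3 * ε₂ * Lr / δ) ≤ ε / 4 := by
    rw [← hCb, hε₂]; apply le_of_eq; field_simp; ring
  obtain ⟨x₀V, hV⟩ := classVariance_of_lowClassSecondMoment θ₁ hθ₁ hL2M ε₁ hε₁0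
  obtain ⟨x₀P, hP⟩ := two_sided_pnt hε₂0
  -- thresholds (eventually in real `x`)
  have hδθ : 0 < δ ^ θ₁ := Real.rpow_pos_of_pos hδ θ₁
  have ev1 := eventually_rpow_le_mul_rpow hθ' hδθ
  have ev2 := eventually_logpow_junk_le hθ₁ (A := 2 ^ t * Cb ^ t) (c := ε / 2 * δ) (by positivity)
    (by positivity) hLr1 t
  have ev3 := eventually_logpow_junk_le hθ₁ (A := 1) (c := δ) zero_le_one hδ hLr1 0
  have ev4 := eventually_logpow_junk_le (θ := 0) zero_lt_one (A := 1) (c := ε₂ * Lr) zero_le_one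
    (by positivity) hLr1 0
  have ev5 : ∀ᶠ x : ℝ in atTop, (max (x₀B : ℝ) (max (x₀V : ℝ) (x₀P : ℝ)) + 2 : ℝ) ≤ δ * x :=
    (tendsto_id.const_mul_atTop hδ).eventually_ge_atTop _
  obtain ⟨N₁, hN₁⟩ := BrunTitchmarshAP.exists_nat_of_eventually
    (ev1.and (ev2.and (ev3.and (ev4.and ev5))))
  refine ⟨max N₁ 1, ?_⟩
  intro N hN q hq _ hqN a b₀ u _ X hX W _ hwin
  obtain ⟨h1, h2, h3, h4, h5⟩ := hN₁ N (le_of_max_le_left hN)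
  simp only [pow_zero, mul_one, one_mul, Real.rpow_zero] at h3 h4
  -- basic facts on `N`, `q`
  have hN1 : (1 : ℝ) ≤ N := by exact_mod_cast le_of_max_le_right hN
  have hN0 : (0 : ℝ) < N := by linarith
  have hq0 : (0 : ℝ) < q := by exact_mod_cast hq
  have hqθ : (q : ℝ) ≤ (N : ℝ) ^ θ₁ := hqN.trans (Real.rpow_le_rpow_of_exponent_le hN1 hθ'.le)
  have hqNr : (q : ℝ) ≤ N := by
    refine hqθ.trans ?_
    have := Real.rpow_le_rpow_of_exponent_le hN1 hθ₁.le
    rwa [Real.rpow_one] at this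
  have hmax0 : (0 : ℝ) ≤ max (x₀B : ℝ) (max (x₀V : ℝ) (x₀P : ℝ)) :=
    le_trans (Nat.cast_nonneg _) (le_max_left _ _)
  have hδN2 : 2 ≤ δ * N := by linarith
  have hδN0 : 0 ≤ δ * N := by linarith
  have hqδN : (q : ℝ) ≤ (δ * N) ^ θ₁ := by
    rw [Real.mul_rpow hδ.le hN0.le]; exact hqN.trans h1
  have hqδN' : (q : ℝ) ≤ δ * N := by
    refine hqδN.trans ?_
    have := Real.rpow_le_rpow_of_exponent_le (by linarith : 1 ≤ δ * N) hθ₁.le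
    rwa [Real.rpow_one] at this
  have hx₀B : (x₀B : ℝ) ≤ δ * N := by linarith [le_max_left (x₀B : ℝ) (max (x₀V : ℝ) (x₀P : ℝ))]
  have hx₀V : (x₀V : ℝ) ≤ δ * N := by
    linarith [le_max_right (x₀B : ℝ) (max (x₀V : ℝ) (x₀P : ℝ)), le_max_left (x₀V : ℝ) (x₀P : ℝ)]
  have hx₀P : (x₀P : ℝ) ≤ δ * N := by
    linarith [le_max_right (x₀B : ℝ) (max (x₀V : ℝ) (x₀P : ℝ)), le_max_right (x₀V : ℝ) (x₀P : ℝ)]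
  have hLrN1 : 1 ≤ Lr * N := by nlinarith
  -- the junk level `J₀ = 4 log³(Lr N)` and its thresholds
  obtain ⟨J₀, hJ₀⟩ : ∃ J₀ : ℝ, J₀ = 4 * Real.log (Lr * N) ^ 3 := ⟨_, rfl⟩
  have hlog0 : 0 ≤ Real.log (Lr * N) := Real.log_nonneg hLrN1
  have hJ00 : 0 ≤ J₀ := by rw [hJ₀]; positivity
  have hJ1 : J₀ * q ≤ δ * N := by
    have hNθ : 0 ≤ (N : ℝ) ^ θ₁ := Real.rpow_nonneg hN0.le _
    calc J₀ * q ≤ J₀ * (N : ℝ) ^ θ₁ := mul_le_mul_of_nonneg_left hqθ hJ00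
      _ = (N : ℝ) ^ θ₁ * (4 * Real.log (Lr * N) ^ 3) := by rw [hJ₀]; ring
      _ ≤ δ * N := h3
  have hJ2 : J₀ ≤ ε₂ * Lr * N := by rw [hJ₀]; linarith [h4]
  have hJ3 : 2 ^ t * (C * Lr / δ + 1) ^ t * ((q : ℝ) / Nat.totient q) ^ t * q * J₀ ≤
      ε / 2 * δ * N := by
    rw [← hCb]
    have hr : (q : ℝ) / Nat.totient q ≤ Real.logb 2 N + 1 := by
      calc _ ≤ (Nat.log 2 q : ℝ) + 1 := self_div_totient_le q hq
        _ ≤ Real.logb 2 q + 1 := by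
            have := Real.natLog_le_logb q 2
            push_cast at this
            linarith
        _ ≤ Real.logb 2 N + 1 := by
            have := Real.logb_le_logb_of_le (b := 2) one_lt_two hq0 hqNr
            linarith
    have hr0 : 0 ≤ (q : ℝ) / Nat.totient q := by positivity
    have hNθ : 0 ≤ (N : ℝ) ^ θ₁ := Real.rpow_nonneg hN0.le _
    have hlb1 : 0 ≤ Real.logb 2 N + 1 := by
      have := Real.logb_nonneg (b := 2) one_lt_two hN1
      linarith
    have hpow : ((q : ℝ) / Nat.totient q) ^ t ≤ (Real.logb 2 N + 1) ^ t := pow_le_pow_left₀ hr0 hr t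
    have h2C : (0 : ℝ) ≤ 2 ^ t * Cb ^ t := by positivity
    calc 2 ^ t * Cb ^ t * ((q : ℝ) / Nat.totient q) ^ t * q * J₀
        ≤ 2 ^ t * Cb ^ t * (Real.logb 2 N + 1) ^ t * (N : ℝ) ^ θ₁ * J₀ := by
          apply mul_le_mul_of_nonneg_right _ hJ00
          exact mul_le_mul (mul_le_mul_of_nonneg_left hpow h2C) hqθ hq0.le
            (mul_nonneg h2C (pow_nonneg hlb1 t))
      _ = 2 ^ t * Cb ^ t * (Real.logb 2 N + 1) ^ t * (N : ℝ) ^ θ₁ * (4 * Real.log (Lr * N) ^ 3) := by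
          rw [hJ₀]
      _ ≤ ε / 2 * δ * N := h2
  -- the bound at one position `n < W` of the windows
  have key2 : ∀ n ∈ range W,
      |∑ c ∈ typeCell q q a b₀,
          ∏ i, (classPsi (a i * n + u i + X i).toNat q (resid q (a i * n + c i)) -
            classPsi (a i * n + u i - 1).toNat q (resid q (a i * n + c i))) -
        (∏ i, ((X i : ℝ) + 1)) / (Nat.totient q : ℝ) ^ t *
          (((typeCell q q a b₀).filter (fun c => ∀ i, Nat.Coprime (c i) q)).card : ℝ)| ≤
      ε * (∏ i, ((X i : ℝ) + 1)) *
        ((((typeCell q q a b₀).filter (fun c => ∀ i, Nat.Coprime (c i) q)).card : ℝ) /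
            (Nat.totient q : ℝ) ^ t + ((typeCell q q a b₀).card : ℝ) / (q : ℝ) ^ t) := by
    intro n hn
    rw [Finset.mem_range] at hn
    -- translate the cell
    rw [sum_typeCell_transl hq a b₀ (n : ℤ) (fun c => ∏ i,
      (classPsi (a i * n + u i + X i).toNat q (c i) - classPsi (a i * n + u i - 1).toNat q (c i)))]
    -- the heights `lo = (a n + u − 1).toNat`, `hi = (a n + u + X).toNat` (part D `window_heights`)
    have hw : ∀ i, (a i * n + u i - 1).toNat ≤ (a i * n + u i + X i).toNat ∧
        δ * N ≤ (((a i * n + u i - 1).toNat : ℕ) : ℝ) ∧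
        (((a i * n + u i + X i).toNat : ℕ) : ℝ) ≤ Lr * N ∧
        (((a i * n + u i + X i).toNat : ℕ) : ℝ) - (((a i * n + u i - 1).toNat : ℕ) : ℝ) = (X i : ℝ) + 1 :=
      fun i => window_heights hδN0 hN0.le hLLr (hwin i n hn).1 (hwin i n hn).2
    have hlo_ge : ∀ i, δ * N ≤ (((a i * n + u i - 1).toNat : ℕ) : ℝ) := fun i => (hw i).2.1
    have hhi_le : ∀ i, (((a i * n + u i + X i).toNat : ℕ) : ℝ) ≤ Lr * N := fun i => (hw i).2.2.1
    have hhi_ge : ∀ i, δ * N ≤ (((a i * n + u i + X i).toNat : ℕ) : ℝ) :=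
      fun i => (hlo_ge i).trans (by exact_mod_cast (hw i).1)
    have hqlo : ∀ i, q ≤ (a i * n + u i - 1).toNat := fun i => by
      have : (q : ℝ) ≤ (((a i * n + u i - 1).toNat : ℕ) : ℝ) := hqδN'.trans (hlo_ge i)
      exact_mod_cast this
    -- level: `q ≤ x^{θ₁}` at both heights
    have hlev : ∀ x : ℕ, δ * N ≤ (x : ℝ) → (q : ℝ) ≤ (x : ℝ) ^ θ₁ := fun x hx =>
      hqδN.trans (Real.rpow_le_rpow hδN0 hx hθ0.le)
    have hthr : ∀ x x₀ : ℕ, (x₀ : ℝ) ≤ δ * N → δ * N ≤ (x : ℝ) → x₀ ≤ x := fun x x₀ h h' => by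
      have : (x₀ : ℝ) ≤ x := h.trans h'
      exact_mod_cast this
    have key := cell_moment_bound q hq a b₀ (fun i => (a i * n + u i - 1).toNat)
      (fun i => (a i * n + u i + X i).toNat) (fun i => (X i : ℝ) + 1) N Lr δ ε C ε₁ ε₂ J₀ hN0 hLr1 hδ hε
      hC hε₁0 hε₂0 hJ00
      (fun i => (hw i).2.2.2) (fun i => by linarith [hX i]) (fun i => (hw i).1) hqlo hhi_le
      (fun i r => hBT _ (hthr _ _ hx₀B (hhi_ge i)) q hq (hlev _ (hhi_ge i)) r)
      (fun i => hV _ (hthr _ _ hx₀V (hhi_ge i)) q hq (hlev _ (hhi_ge i)))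
      (fun i => hV _ (hthr _ _ hx₀V (hlo_ge i)) q hq (hlev _ (hlo_ge i)))
      (fun i => hP _ (hthr _ _ hx₀P (hhi_ge i)))
      (fun i => hP _ (hthr _ _ hx₀P (hlo_ge i)))
      (fun i => by
        rw [hJ₀]
        have hpos : (0 : ℝ) < (((a i * n + u i + X i).toNat : ℕ) : ℝ) :=
          lt_of_lt_of_le (by linarith) (hhi_ge i)
        have hl : Real.log (((a i * n + u i + X i).toNat : ℕ) : ℝ) ≤ Real.log (Lr * N) :=
          Real.log_le_log hpos (hhi_le i)
        have hl0 : 0 ≤ Real.log (((a i * n + u i + X i).toNat : ℕ) : ℝ) :=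
          Real.log_nonneg (by linarith [hhi_ge i])
        gcongr)
      hJ1 hJ2 hJ3 hE1 hE2
    exact key
  -- summing over the positions
  rw [coprimePairs_eq_mul_card q hq a b₀ W, Nat.cast_mul]
  exact abs_sum_sub_le _ _ _ _ _ key2 (by ring) (by ring)

end TCM

/-- **`stub_typeClassMoments`** (registered stub of the reshaped line gallagher-backwards-split, crux
stmt-Parity-14113): `LowClassSecondMoment θ₁ → TypeClassMoments θ₁'` for `θ₁' < θ₁ < 1`. -/
theorem stub_typeClassMoments : ∀ θ₁ θ₁' : ℝ, θ₁' < θ₁ → θ₁ < 1 → LowClassSecondMoment θ₁ → TypeClassMoments θ₁' := by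
  intro θ₁ θ₁' hθ' hθ₁ hL2M
  by_cases hθ0 : 0 < θ₁
  · exact TCM.typeClassMoments_of_pos hθ' hθ₁ hθ0 hL2M
  · exact TCM.typeClassMoments_of_neg θ₁' (lt_of_lt_of_le hθ' (not_lt.1 hθ0))

end Summit.Parity.GeneralizedHardyLittlewood.Cruxes.RelativeDimOne.TypeSplit

end
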